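import Summits.QuantumFields.YangMills.Theorems.VirialFluxGapDeficitForm
import Summits.QuantumFields.YangMills.Theses.VirialFluxGap
import HarnessLib

/-!
# The CHART-FREE END ASSEMBLY of the direct Laplace road to ⟨stmt-QuantumFields-24204⟩ `VirialFluxGap.SharpTwistedLaplace`
# (layer (C): per-`(L,z)` two-sided orbit-Laplace law with polynomial data ⇒ the leaf BY NAME)

Helper module (free-hands work of width seat ym-line-sfw-p2-w3 g56, cell ym-idea-1; `--supports 24204`).  The direct road of width seat
w2 g49 evaluates `∫ e^{−βF_z} dμ_L` (`F_z = RingDeficit.ringDeficit L z ≥ 0`, `μ_L = RingDeficit.ringMeasure L`) by the QUANTITATIVE Laplace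
method on the finitely many rigid twist-eater gauge orbits of the zero set of `F_z` (✓`QuantitativeLaplace.laplaceMethod_quantitative_orbit_tube`
per orbit, ✓`…_sum_of_tubes` for the bookkeeping, ✓`ringDeficit_floor_off_tube` = ✓⟨24320⟩ for the separation off the tubes).  Whatever the charts
look like, the OUTPUT of that layer for one `(L, z)` has the fixed shape

  `|∫ e^{−βF_z} dμ_L − M·β^{−9L⁴}| ≤ (K L^q / β)·M·β^{−9L⁴} + e^{−βη₀}`      for `β ≥ K L^q`,

with `M = M(L,z) > 0` the one-loop constant (`Σ_orbits ν(𝒢)·w₀·(2π)^{9L⁴}/√det A`; transversal dimension `18L⁴`), `log M ≥ −K L^q`, and a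
separation floor `η₀ ≥ (K L^q)⁻¹` off the tubes.  THIS FILE proves, once and for all, that such an ORBIT LAPLACE LAW implies the leaf
`SharpTwistedLaplace` BY NAME (★★ `sharpTwistedLaplace_of_orbitLaplaceLaw`), with `C(L,z) := log M(L,z)`, remainder constant `2K + 2`, the
same `q`, and the window `L ≤ β^a`, `a = 1/(4q + 12)`:
* §1 `abs_log_one_add_le` — `|log(1+θ)| ≤ 2|θ|` for `|θ| ≤ 1/2`; `abs_log_sub_log_le` — the log of a quantity within relative `θ` of a positive
  main term;
* §2 the WINDOW ARITHMETIC of the direct road (`window_threshold`, `window_tail`): on `L ≤ β^a`, `β ≥ β₀(K,q)` one has `K L^q ≤ β/4` and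
  `β·η₀ ≥ (9L⁴+1)·log β + K L^q`, so the separated complement `e^{−βη₀}` is below `β⁻¹·M β^{−9L⁴}` (uses `log β ≤ β^a/a`, ✓`Real.log_le_rpow_div`);
* §3 ★★ the assembly: `log W_z(β) = 12βL⁴ + log ∫e^{−βF_z}dμ_L` (✓`RingDeficit.log_sectorWeight_eq`) `= 12βL⁴ − 9L⁴ log β + log M + log(1+θ)` with
  `|θ| ≤ K L^q/β + 1/β ≤ 1/2`, hence `|log W_z − (12βL⁴ − 9L⁴ log β + C(L,z))| ≤ (2K+2)·L^q/β`.
So the chart layer owes exactly the displayed law with polynomial constants — no Tauberian step, no sublevel volumes, and no coupling of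
the window to `|log M|` beyond the one-sided bound `log M ≥ −K L^q`.

Everything here is PROVED; no definitions, no named facts (namespace `Summit.QuantumFields.YangMills.Theorems.VirialFluxGap.OrbitAssembly`).
HONEST FRAMING: real-analysis plumbing; ⟨24204⟩, ⟨24319⟩ and every rung stay OPEN until the orbit Laplace law itself is supplied; the
Yang–Mills mass gap (Clay) is NOT touched; no summit is proved by a line.

## References
* K. W. Breitung, *Asymptotic Approximations for Probability Integrals*, LNM 1592 (1994), Thm 41 p. 56, Thm 56. [Breitung1994]
* I. Montvay, G. Münster, *Quantum Fields on a Lattice* (1994), (3.145). [MontvayMunster1994]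
* M. Lüscher, Nucl. Phys. B219 (1983), §2. [Luscher1983]
-/

set_option autoImplicit false

noncomputable section

open MeasureTheory Filter Set Function
open scoped BigOperators Topology
open Literature.MathematicalPhysics.QuantumFieldTheory hiding SU2
open Summit.QuantumFields.YangMills.Theorems.FemtoTransferGap
open Summit.QuantumFields.YangMills.Theorems.FemtoTransferGap.TT
open Summit.QuantumFields.YangMills.Theorems.VirialFluxGap.RingDeficit

namespace Summit.QuantumFields.YangMills.Theorems.VirialFluxGap.OrbitAssembly

/-! ## §1 Logarithmic bookkeeping -/

/-- `|log(1+θ)| ≤ 2|θ|` for `|θ| ≤ 1/2` (from `1 − x⁻¹ ≤ log x ≤ x − 1`). [folklore] -/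
theorem abs_log_one_add_le {θ : ℝ} (hθ : |θ| ≤ 1 / 2) : |Real.log (1 + θ)| ≤ 2 * |θ| := by
  have hθ1 : -(1 / 2 : ℝ) ≤ θ := by linarith [neg_abs_le θ, hθ]
  have hθ2 : θ ≤ 1 / 2 := le_trans (le_abs_self θ) hθ
  have hpos : 0 < 1 + θ := by linarith
  have hup : Real.log (1 + θ) ≤ θ := by
    have := Real.log_le_sub_one_of_pos hpos; linarith
  have hlow : 1 - (1 + θ)⁻¹ ≤ Real.log (1 + θ) := Real.one_sub_inv_le_log_of_pos hpos
  -- `1 − (1+θ)⁻¹ = θ/(1+θ) ≥ -2|θ|`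
  have hlow' : -(2 * |θ|) ≤ 1 - (1 + θ)⁻¹ := by
    rw [show 1 - (1 + θ)⁻¹ = θ / (1 + θ) by field_simp; ring]
    rw [le_div_iff₀ hpos]
    nlinarith [abs_nonneg θ, neg_abs_le θ, le_abs_self θ]
  rw [abs_le]
  constructor <;> linarith [le_abs_self θ]

/-- The log of a quantity within relative `θ`, `|θ| ≤ 1/2`, of a positive main term: if `0 < m` and `|I − m| ≤ θ₀·m` with `θ₀ ≤ 1/2`, then
`0 < I` and `|log I − log m| ≤ 2θ₀`. [folklore] -/
theorem abs_log_sub_log_le {I m θ₀ : ℝ} (hm : 0 < m) (hθ₀ : θ₀ ≤ 1 / 2) (h : |I - m| ≤ θ₀ * m) :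
    0 < I ∧ |Real.log I - Real.log m| ≤ 2 * θ₀ := by
  have hθ₀0 : 0 ≤ θ₀ := by
    by_contra hneg
    have hneg' : θ₀ < 0 := lt_of_not_ge hneg
    have : θ₀ * m < 0 := mul_neg_of_neg_of_pos hneg' hm
    linarith [abs_nonneg (I - m)]
  set θ : ℝ := (I - m) / m with hθdef
  have hI : I = m * (1 + θ) := by rw [hθdef]; field_simp; ring
  have hθabs : |θ| ≤ θ₀ := by
    rw [hθdef, abs_div, abs_of_pos hm, div_le_iff₀ hm]; exact h
  have hθhalf : |θ| ≤ 1 / 2 := hθabs.trans hθ₀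
  have h1θ : 0 < 1 + θ := by linarith [neg_abs_le θ, hθhalf]
  have hIpos : 0 < I := by rw [hI]; exact mul_pos hm h1θ
  refine ⟨hIpos, ?_⟩
  rw [hI, Real.log_mul hm.ne' h1θ.ne', add_sub_cancel_left]
  exact (abs_log_one_add_le hθhalf).trans (by linarith)

/-! ## §2 Window arithmetic of the direct road -/

/-- Monomial bookkeeping on the window: `1 ≤ L ≤ β^a`, `0 ≤ s` ⇒ `L^s ≤ β^{a s}`. [folklore] -/
theorem rpow_window_le {L β a s : ℝ} (hL : 1 ≤ L) (hLβ : L ≤ β ^ a) (hβ : 1 ≤ β) (hs : 0 ≤ s) :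
    L ^ s ≤ β ^ (a * s) := by
  rw [Real.rpow_mul (by linarith)]
  exact Real.rpow_le_rpow (by linarith) hLβ hs

/-- ★ **Threshold arithmetic.**  For `K > 0`, `q ≥ 0`, `a = 1/(4q+12)`, `β ≥ 1` with `(4K)·β^{1/2} ≤ β` (e.g. `β ≥ (4K)²`) and
`1 ≤ L ≤ β^a`: `K·L^q ≤ β/4`. [folklore] -/
theorem window_threshold {K q a β L : ℝ} (hK : 0 < K) (hq : 0 ≤ q) (ha : a = 1 / (4 * q + 12)) (hβ : 1 ≤ β)
    (hβK : 4 * K * β ^ (1 / 2 : ℝ) ≤ β) (hL : 1 ≤ L) (hLβ : L ≤ β ^ a) : K * L ^ q ≤ β / 4 := by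
  have ha0 : 0 < a := by rw [ha]; positivity
  have haq : a * q ≤ 1 / 2 := by
    rw [ha, div_mul_eq_mul_div, one_mul, div_le_iff₀ (by positivity)]; linarith
  have h1 : L ^ q ≤ β ^ (a * q) := rpow_window_le hL hLβ hβ hq
  have h2 : β ^ (a * q) ≤ β ^ (1 / 2 : ℝ) := Real.rpow_le_rpow_of_exponent_le hβ haq
  have h3 : K * L ^ q ≤ K * β ^ (1 / 2 : ℝ) := mul_le_mul_of_nonneg_left (h1.trans h2) hK.le
  linarith

/-- ★ **Tail arithmetic.**  For `K > 0`, `q ≥ 0`, `a = 1/(4q+12)`, `β ≥ 1` with `(10K/a + K²)·β^{1/2} ≤ β`, `1 ≤ L ≤ β^a` and a separation floor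
`(K L^q)⁻¹ ≤ η₀`: `(9L⁴ + 1)·log β + K·L^q ≤ β·η₀`. [folklore] -/
theorem window_tail {K q a β L η₀ : ℝ} (hK : 0 < K) (hq : 0 ≤ q) (ha : a = 1 / (4 * q + 12)) (hβ : 1 ≤ β)
    (hβK : (10 * K / a + K ^ 2) * β ^ (1 / 2 : ℝ) ≤ β) (hL : 1 ≤ L) (hLβ : L ≤ β ^ a) (hη : (K * L ^ q)⁻¹ ≤ η₀) :
    (9 * L ^ 4 + 1) * Real.log β + K * L ^ q ≤ β * η₀ := by
  have ha0 : 0 < a := by rw [ha]; positivity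
  have hβ0 : 0 < β := by linarith
  have hL0 : 0 < L := by linarith
  have hKL : 0 < K * L ^ q := by positivity
  -- it suffices to bound `K L^q · ((9L⁴+1) log β + K L^q) ≤ β`
  have hη' : β / (K * L ^ q) ≤ β * η₀ := by
    rw [div_eq_mul_inv]; exact mul_le_mul_of_nonneg_left hη hβ0.le
  refine le_trans ?_ hη'
  rw [le_div_iff₀ hKL]
  -- monomials on the window
  have hlog : Real.log β ≤ β ^ a / a := Real.log_le_rpow_div hβ0.le ha0
  have hlog0 : 0 ≤ Real.log β := Real.log_nonneg hβ
  have hLq : L ^ q ≤ β ^ (a * q) := rpow_window_le hL hLβ hβ hq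
  have hL4 : L ^ (4 : ℝ) ≤ β ^ (a * 4) := rpow_window_le hL hLβ hβ (by norm_num)
  -- exponent bookkeeping: a(q+5) ≤ 1/2 and 2aq ≤ 1/2
  have h12 : a * (4 * q + 12) = 1 := by rw [ha]; field_simp
  have haq0 : 0 ≤ a * q := mul_nonneg ha0.le hq
  have he1 : a * q + a * 4 + a ≤ 1 / 2 := by nlinarith [h12, haq0, ha0]
  have he2 : a * q + a * q ≤ 1 / 2 := by nlinarith [h12, haq0, ha0]
  have hβaq : 0 < β ^ (a * q) := Real.rpow_pos_of_pos hβ0 _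
  have hβa4 : 0 < β ^ (a * 4) := Real.rpow_pos_of_pos hβ0 _
  have hβa : 0 < β ^ a := Real.rpow_pos_of_pos hβ0 _
  -- first summand: `(9L⁴+1) log β · K L^q ≤ 10 K β^{aq} β^{4a} β^{a}/a = (10K/a) β^{aq+4a+a} ≤ (10K/a) β^{1/2}`
  have hA : (9 * L ^ 4 + 1) * Real.log β * (K * L ^ q) ≤ 10 * K / a * β ^ (1 / 2 : ℝ) := by
    have hL4n : L ^ (4 : ℕ) ≤ β ^ (a * 4) := by
      rw [← Real.rpow_natCast]; exact_mod_cast hL4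
    have h1 : (1 : ℝ) ≤ β ^ (a * 4) := Real.one_le_rpow hβ (by positivity)
    have h91 : 9 * L ^ (4 : ℕ) + 1 ≤ 10 * β ^ (a * 4) :=
      calc 9 * L ^ (4 : ℕ) + 1 ≤ 9 * β ^ (a * 4) + β ^ (a * 4) := add_le_add (mul_le_mul_of_nonneg_left hL4n (by norm_num)) h1
        _ = 10 * β ^ (a * 4) := by ring
    have step1 : (9 * L ^ 4 + 1) * Real.log β * (K * L ^ q) ≤ (10 * β ^ (a * 4)) * (β ^ a / a) * (K * β ^ (a * q)) := by
      have i1 : K * L ^ q ≤ K * β ^ (a * q) := mul_le_mul_of_nonneg_left hLq hK.le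
      have i2 : (9 * L ^ 4 + 1) * Real.log β ≤ (10 * β ^ (a * 4)) * (β ^ a / a) := mul_le_mul h91 hlog hlog0 (by positivity)
      exact mul_le_mul i2 i1 hKL.le (by positivity)
    have step2 : (10 * β ^ (a * 4)) * (β ^ a / a) * (K * β ^ (a * q)) = 10 * K / a * β ^ (a * q + a * 4 + a) := by
      rw [Real.rpow_add hβ0, Real.rpow_add hβ0]; field_simp
    have step3 : β ^ (a * q + a * 4 + a) ≤ β ^ (1 / 2 : ℝ) := Real.rpow_le_rpow_of_exponent_le hβ he1
    calc _ ≤ _ := step1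
      _ = _ := step2
      _ ≤ 10 * K / a * β ^ (1 / 2 : ℝ) := mul_le_mul_of_nonneg_left step3 (by positivity)
  -- second summand: `K L^q · K L^q ≤ K² β^{2aq} ≤ K² β^{1/2}`
  have hB : K * L ^ q * (K * L ^ q) ≤ K ^ 2 * β ^ (1 / 2 : ℝ) := by
    have step1 : K * L ^ q * (K * L ^ q) ≤ K * β ^ (a * q) * (K * β ^ (a * q)) :=
      mul_le_mul (mul_le_mul_of_nonneg_left hLq hK.le) (mul_le_mul_of_nonneg_left hLq hK.le) hKL.le (by positivity)
    have step2 : K * β ^ (a * q) * (K * β ^ (a * q)) = K ^ 2 * β ^ (a * q + a * q) := by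
      rw [Real.rpow_add hβ0]; ring
    have step3 : β ^ (a * q + a * q) ≤ β ^ (1 / 2 : ℝ) := Real.rpow_le_rpow_of_exponent_le hβ he2
    calc _ ≤ _ := step1
      _ = _ := step2
      _ ≤ K ^ 2 * β ^ (1 / 2 : ℝ) := mul_le_mul_of_nonneg_left step3 (by positivity)
  calc ((9 * L ^ 4 + 1) * Real.log β + K * L ^ q) * (K * L ^ q)
      = (9 * L ^ 4 + 1) * Real.log β * (K * L ^ q) + K * L ^ q * (K * L ^ q) := by ring
    _ ≤ 10 * K / a * β ^ (1 / 2 : ℝ) + K ^ 2 * β ^ (1 / 2 : ℝ) := add_le_add hA hB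
    _ = (10 * K / a + K ^ 2) * β ^ (1 / 2 : ℝ) := by ring
    _ ≤ β := hβK

/-! ## §3 ★★ The assembly -/

/-- ★★ **The orbit Laplace law implies the sharp twisted Laplace law (leaf `VirialFluxGap.SharpTwistedLaplace`, BY NAME).**
HYPOTHESIS (the fixed output shape of the direct Laplace road — quantitative Laplace on the twist-eater orbits, summed over the finitely many
orbits, plus the separation off the tubes): there are `K > 0`, `q ≥ 0`, `L₀` such that for every `L ≥ L₀` and every twist `z ≠ 0` there are a
constant `M > 0` with `log M ≥ −K L^q` and a floor `η₀ ≥ (K L^q)⁻¹` with, for every `β ≥ K L^q`,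
`|∫ e^{−βF_z} dμ_L − M β^{−9L⁴}| ≤ (K L^q/β)·M β^{−9L⁴} + e^{−βη₀}`.
CONCLUSION: `SharpTwistedLaplace` with `C(L,z) = log M(L,z)`, remainder `(2K+2)·L^q/β`, window exponent `a = 1/(4q+12)`.
No crux / rung / summit is proved by this implication alone; the YM mass gap is NOT proved.
[cite: Breitung1994, Thm 41 p. 56 and Thm 56 (6.31)] [cite: MontvayMunster1994, (3.145)] -/
theorem sharpTwistedLaplace_of_orbitLaplaceLaw
    (h : ∃ K : ℝ, 0 < K ∧ ∃ q : ℝ, 0 ≤ q ∧ ∃ L₀ : ℕ, ∀ (L : ℕ) [NeZero L], L₀ ≤ L →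
      ∀ z : Fin 3 → Bool, z ≠ (fun _ => false) →
        ∃ M : ℝ, 0 < M ∧ -(K * (L : ℝ) ^ q) ≤ Real.log M ∧
          ∃ η₀ : ℝ, (K * (L : ℝ) ^ q)⁻¹ ≤ η₀ ∧
            ∀ β : ℝ, K * (L : ℝ) ^ q ≤ β →
              |(∫ p, Real.exp (-(β * ringDeficit L z p)) ∂(ringMeasure L)) - M * β ^ (-(9 * (L : ℝ) ^ 4))| ≤
                K * (L : ℝ) ^ q / β * (M * β ^ (-(9 * (L : ℝ) ^ 4))) + Real.exp (-(β * η₀))) :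
    Summit.QuantumFields.YangMills.Theses.VirialFluxGap.SharpTwistedLaplace := by
  classical
  obtain ⟨K, hK, q, hq, L₀, h⟩ := h
  -- the constant `C(L,z) := log M(L,z)` (junk `0` outside the range of the hypothesis)
  let C : ℕ → (Fin 3 → Bool) → ℝ := fun L z =>
    if hLz : L ≠ 0 ∧ L₀ ≤ L ∧ z ≠ (fun _ => false) then
      Real.log (Classical.choose (@h L ⟨hLz.1⟩ hLz.2.1 z hLz.2.2))
    else 0
  set a : ℝ := 1 / (4 * q + 12) with ha
  have ha0 : 0 < a := by rw [ha]; positivity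
  refine ⟨2 * K + 2, q, C, a, ha0, max 4 ((10 * K / a + K ^ 2 + 4 * K) ^ 2), max L₀ 1, ?_⟩
  intro β hβ L _ hL hLβ z hz
  have hL₀ : L₀ ≤ L := le_trans (le_max_left _ _) hL
  have hL1 : 1 ≤ L := le_trans (le_max_right _ _) hL
  have hLr : (1 : ℝ) ≤ (L : ℝ) := by exact_mod_cast hL1
  have hLne : L ≠ 0 := by omega
  have hβ4 : (4 : ℝ) ≤ β := le_trans (le_max_left _ _) hβ
  have hβ1 : (1 : ℝ) ≤ β := by linarith
  have hβ0 : (0 : ℝ) < β := by linarith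
  -- unpack the hypothesis at `(L, z)` and identify `C L z`
  have hCdef : C L z = Real.log (Classical.choose (@h L _ hL₀ z hz)) := by
    simp only [C, dif_pos (show L ≠ 0 ∧ L₀ ≤ L ∧ z ≠ (fun _ => false) from ⟨hLne, hL₀, hz⟩)]
  set M : ℝ := Classical.choose (@h L _ hL₀ z hz) with hMdef
  obtain ⟨hM, hlogM, η₀, hη₀, hlaw⟩ := Classical.choose_spec (@h L _ hL₀ z hz)
  rw [← hMdef] at hM hlogM hlaw
  -- the square-root thresholds: `c β^{1/2} ≤ β` as soon as `β ≥ c²`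
  have hsqrt : ∀ c : ℝ, 0 ≤ c → c ^ 2 ≤ β → c * β ^ (1 / 2 : ℝ) ≤ β := by
    intro c hc hcβ
    have hroot : c ≤ β ^ (1 / 2 : ℝ) := by
      have : (c ^ 2) ^ (1 / 2 : ℝ) ≤ β ^ (1 / 2 : ℝ) := Real.rpow_le_rpow (by positivity) hcβ (by norm_num)
      rwa [← Real.sqrt_eq_rpow, Real.sqrt_sq hc] at this
    calc c * β ^ (1 / 2 : ℝ) ≤ β ^ (1 / 2 : ℝ) * β ^ (1 / 2 : ℝ) :=
          mul_le_mul_of_nonneg_right hroot (Real.rpow_nonneg hβ0.le _)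
      _ = β := by rw [← Real.rpow_add hβ0]; norm_num
  have hbig : (10 * K / a + K ^ 2 + 4 * K) ^ 2 ≤ β := le_trans (le_max_right _ _) hβ
  have hc1 : 4 * K * β ^ (1 / 2 : ℝ) ≤ β := by
    refine le_trans ?_ (hsqrt _ (by positivity) hbig)
    have h10 : 0 ≤ 10 * K / a := by positivity
    exact mul_le_mul_of_nonneg_right (by nlinarith [hK, sq_nonneg K, h10]) (Real.rpow_nonneg hβ0.le _)
  have hc2 : (10 * K / a + K ^ 2) * β ^ (1 / 2 : ℝ) ≤ β := by
    refine le_trans ?_ (hsqrt _ (by positivity) hbig)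
    exact mul_le_mul_of_nonneg_right (by nlinarith [hK]) (Real.rpow_nonneg hβ0.le _)
  have hthr : K * (L : ℝ) ^ q ≤ β / 4 := window_threshold hK hq ha hβ1 hc1 hLr hLβ
  have htail : (9 * (L : ℝ) ^ 4 + 1) * Real.log β + K * (L : ℝ) ^ q ≤ β * η₀ :=
    window_tail hK hq ha hβ1 hc2 hLr hLβ hη₀
  -- the law at this `β`
  have hKLβ : K * (L : ℝ) ^ q ≤ β := by linarith
  have hI := hlaw β hKLβ
  set main : ℝ := M * β ^ (-(9 * (L : ℝ) ^ 4)) with hmain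
  have hmain_pos : 0 < main := mul_pos hM (Real.rpow_pos_of_pos hβ0 _)
  have hlog_main : Real.log main = Real.log M - 9 * (L : ℝ) ^ 4 * Real.log β := by
    rw [hmain, Real.log_mul hM.ne' (Real.rpow_pos_of_pos hβ0 _).ne', Real.log_rpow hβ0]; ring
  -- the separated complement is below `β⁻¹ · main`
  have htail' : Real.exp (-(β * η₀)) ≤ 1 / β * main := by
    have h1 : Real.exp (-(β * η₀)) ≤ Real.exp (-((9 * (L : ℝ) ^ 4 + 1) * Real.log β + K * (L : ℝ) ^ q)) :=
      Real.exp_le_exp.mpr (by linarith)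
    refine h1.trans ?_
    have h2 : 1 / β * main = Real.exp (-Real.log β + Real.log main) := by
      rw [Real.exp_add, Real.exp_neg, Real.exp_log hβ0, Real.exp_log hmain_pos, one_div]
    rw [h2, Real.exp_le_exp, hlog_main]
    linarith
  -- relative error `θ₀ = K L^q/β + 1/β ≤ 1/2`
  have hrel : |(∫ p, Real.exp (-(β * ringDeficit L z p)) ∂(ringMeasure L)) - main| ≤ (K * (L : ℝ) ^ q / β + 1 / β) * main := by
    calc _ ≤ K * (L : ℝ) ^ q / β * main + Real.exp (-(β * η₀)) := hI
      _ ≤ K * (L : ℝ) ^ q / β * main + 1 / β * main := add_le_add le_rfl htail'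
      _ = (K * (L : ℝ) ^ q / β + 1 / β) * main := by ring
  have hθ₀ : K * (L : ℝ) ^ q / β + 1 / β ≤ 1 / 2 := by
    have h1 : K * (L : ℝ) ^ q / β ≤ 1 / 4 := by
      rw [div_le_iff₀ hβ0]; linarith
    have h2 : 1 / β ≤ 1 / 4 := by
      rw [div_le_div_iff₀ hβ0 (by norm_num)]; linarith
    linarith
  obtain ⟨_, hlogI⟩ := abs_log_sub_log_le hmain_pos hθ₀ hrel
  -- conclude
  rw [log_sectorWeight_eq β z, hCdef]
  have hLq1 : (1 : ℝ) ≤ (L : ℝ) ^ q := Real.one_le_rpow hLr hq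
  have e : 12 * β * (L : ℝ) ^ 4 + Real.log (∫ p, Real.exp (-(β * ringDeficit L z p)) ∂ringMeasure L) -
        (12 * β * (L : ℝ) ^ 4 - 9 * (L : ℝ) ^ 4 * Real.log β + Real.log M) =
      Real.log (∫ p, Real.exp (-(β * ringDeficit L z p)) ∂ringMeasure L) - Real.log main := by
    rw [hlog_main]; ring
  rw [e]
  calc |Real.log (∫ p, Real.exp (-(β * ringDeficit L z p)) ∂ringMeasure L) - Real.log main|
      ≤ 2 * (K * (L : ℝ) ^ q / β + 1 / β) := hlogI
    _ = (2 * K * (L : ℝ) ^ q + 2) / β := by ring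
    _ ≤ (2 * K + 2) * (L : ℝ) ^ q / β := by
          apply div_le_div_of_nonneg_right _ hβ0.le
          nlinarith [hLq1, hK.le]

end Summit.QuantumFields.YangMills.Theorems.VirialFluxGap.OrbitAssembly

end
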